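import Literature.NumberTheory.LFunctions.KowalskiMichelPeterssonBoundWeilFree
import Literature.NumberTheory.LFunctions.WeightTwoBesselModeIntegral
import Literature.NumberTheory.LFunctions.KowalskiMichelPeterssonNewformExpansion
import Literature.NumberTheory.ModularForms.PoincareSeriesWeightTwoHecke
import Literature.NumberTheory.ModularForms.PoincareSeriesWeightTwoHeckeConvergence
import Literature.NumberTheory.ModularForms.PoincareSeriesWeightTwoHeckeLimit
import Literature.NumberTheory.ModularForms.PoincareSeriesWeightTwoHeckeUnfolding
import Literature.NumberTheory.ModularForms.PoincareSeriesWeightTwoCuspFormOfL2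
import Literature.NumberTheory.ModularForms.PoincareSeriesWeightTwoL2OfDominated
import Literature.NumberTheory.ModularForms.PoincareSeriesWeightTwoQSeriesHolomorphic
import Literature.NumberTheory.ModularForms.PoincareSeriesWeightTwoFourierModes
import Literature.NumberTheory.ModularForms.PoincareSeriesWeightTwoHeckeAssembly
import Literature.NumberTheory.LFunctions.KowalskiMichelPeterssonFormulaOfHeckeL2Prime
import Literature.NumberTheory.ModularForms.PoincareSeriesWeightTwoHeckeContinuous
import Literature.NumberTheory.ModularForms.PoincareSeriesWeightTwoHeckeSqIntegrable
import Literature.NumberTheory.ModularForms.PoincareSeriesWeightTwoL2OfGram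
import Literature.NumberTheory.ModularForms.PoincareSeriesWeightTwoGramLimit
import Literature.NumberTheory.ModularForms.PoincareSeriesWeightTwoHeckeMajorant
import Summits.Parity.GeneralizedHardyLittlewood.Theorems.PrimeLevelFamEdgePeterssonBoundOfFormula
import Mathlib.Analysis.Complex.UpperHalfPlane.Manifold
import HarnessLib

/-!
# FACT SKELETON I1, v5 (CLOSED — 0 sorries) — line `poincare-hecke` — for
# `Literature.NumberTheory.LFunctions.KowalskiMichel2000.kowalskiMichel2000_peterssonFormula`
(Kowalski–Michel 2000, §2.4.2 p. 312: Petersson's formula at prime level `q`, weight `2`,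
`∑ʰ_f λ_f(l₁)λ_f(l₂) = δ(l₁,l₂) − J(l₁,l₂)`, `J(l₁,l₂) = (2π/q) ∑_{r≥1} r⁻¹ S(l₁,l₂;qr) J₁(4π√(l₁l₂)/(qr))`.)

Cell `landau-siegel`, sub-cell `ls-inputs` (D-0154 (2)), seat `ls-inputs-I1-lead`. Consumers:
stmt-Parity-20404 (`PeterssonBoundPrinted`), PLFE `closes` hP. v1 (sha16 be90a83a7e6d5b08, crit PASS
06:23:20Z) had 4 stubs; S1 `stub_parsevalNewforms` LANDED (p609201, lead:
`KowalskiMichel2000.cuspCoeff_eq_mul_pet_of_peterssonProduct_eq`), S2 `stub_besselModeIntegral` LANDED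
(p609912, worker w1: `Literature.NumberTheory.LFunctions.weightTwo_besselModeIntegral`).

## v2 = RESHAPE of the XL stubs S3 `stub_poincareCuspForm` + S4 `stub_poincareReproducing` into the
## Hecke–Selberg `L²` line (7 registered stubs over the definitions file p611295)

Objects (the tree's DEFINITIONS file `Literature/NumberTheory/ModularForms/PoincareSeriesWeightTwoHecke.lean`,
p611295 ACCEPTED, namespace `Literature.NumberTheory.ModularForms.PoincareWeightTwo`): rows `Row N`, the explicit matrix
`rowMatrix`, `rowDenom v z = cz+d`, the Hecke-regularised weight-2 Poincaré series
`poincareHecke N m s z = ½ Σ_{(c,d)=1,N∣c} (cz+d)⁻²|cz+d|^{−2s} e(mγ_{(c,d)}z)` (`s > 0`), the printed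
coefficient `poincareCoeff N m n = δ(m,n) − √n/√m·petJ N m n` and its `q`-series `poincareQSeries`,
the cell integral `modeIntegral`, the Petersson pairing of FUNCTIONS `peterssonPairing N k g₁ g₂` (same
body as the tree's `peterssonProduct`) and `PeterssonSqIntegrable`.

The line (Hecke 1927 / Iwaniec–Kowalski §14.1–§14.2 with §3.2; Selberg's `L²` form of the limit):
* T1 `stub_heckeConvergence` [M] — **CLOSED p612322** (`PoincareWeightTwo.heckeConvergence`): absolute convergence and weight-`(2,s)` automorphy of `P_m(·,s)`, `s>0`.
* T2 `stub_heckeFourierModes` [L]: the Fourier modes of `P_m(·,s)` along `Im z = y`: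
  `δ_{mn}e^{−2πmy} + Σ_{c≡0(N)} c^{−2−2s} S(m,n;c) I_s(m/c²,n;y)` (rows → Kloosterman sums, Poisson/unfolding
  of the `d`-sum; weight-2 analogue of the tree's PROVED weight-0 `Fuchsian.fourierMode_poincarePair_*`);
  numerically cross-checked at `s = 1` (card).
* T3 `stub_heckeLimit` [M/L]: `T2 →` pointwise Hecke limit `P_m(z,s) → poincareQSeries N m z` (`s→0⁺`)
  (termwise: S2 at `s = 0`, Weil for the `c`-sum, `n⁻²` decay of the modes for the `n`-sum).
* U `stub_heckeUnfolding` [L]: unfolding at `s>0`: `⟨yˢP_m(·,s), f⟩ = Γ(s+1)(4πm)^{−s−1} a_f(m)` for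
  `f ∈ S_2(Γ₀(N))` (tree: `Gamma0UnfoldingProofs.integral_fd_sum_tsum_smul_eq`, strip integral).
* T4 `stub_heckeL2` [L]: `T1 → T2 → U →` the family `yˢP_m(·,s)` converges to `poincareQSeries N m` in the
  weight-2 `L²` norm of `Γ₀(N)\ℍ` (Gram limit `⟨E_s,E_{s'}⟩` by unfolding + T2, Cauchy, identification of
  the limit by T3).
* T5 `stub_cuspFormOfL2` [M/L]: an `L²` holomorphic weight-2 `Γ₀(N)`-invariant function IS a cusp form
  (sub-mean-value ⇒ bounded at every cusp ⇒ Mathlib `q`-expansion; `L²` kills the constant terms).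
* T7 `stub_poincareAssembly` [M]: `T1 → T3 → U → T4 → T5 →` there is `P ∈ S_2(Γ₀(N))` with
  `a_P(n) = poincareCoeff N m n` and `⟨P,f⟩ = a_f(m)/(4πm)` (holomorphy of the `q`-series, invariance in the
  limit, `q`-expansion uniqueness, Cauchy–Schwarz for the pairing, `Γ(s+1)(4πm)^{−s−1} → (4πm)⁻¹`).
* KERNEL: `poincareExists` (T-stubs composed), `peterssonFormula_of_hyps` (S1 + `poincareExists` ⇒ fact,
  the v1 algebra), `peterssonFormula_of` (the fact BY NAME), `PeterssonBoundPrinted_of` (the crux BY NAME).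

## v4 (2026-08-28T09:25Z) = PRIME-LEVEL composition (one open stub T4m `stub_heckeMajorantPrime`)
The crux is a statement at PRIME level `q`, so the `L²` half of the line is now composed POINTWISE in the
level through the landed `poincareAssembly_at` / `heckeL2_at_of_domination_at` /
`peterssonFormula_of_heckeL2_prime` (p619632, `KowalskiMichelPeterssonFormulaOfHeckeL2Prime.lean`) and
`peterssonFormula_of_heckeL2` (p618945): `HeckeL2Prime` / `HeckeDominationPrime` / `PoincareExistsPrime` are
the v3 Props with `N.Prime →` inserted after `[NeZero N]`.  The ONE open stub is
T4m `stub_heckeMajorantPrime : HeckeConvergence → HeckeFourierModes → HeckeMajorantPrime` (the uniform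
majorant, conjunct (iii); worker w3: expansion at `∞` + the coset series at the cusp `0` of `Γ₀(q)`,
`SL₂(ℤ) = Γ₀(q) ⊔ ⨆_j Γ₀(q)ST^j`); T4a′ `stub_heckeDominationPrime` is KERNEL from it with (i) = p618045
`continuous_rpow_im_mul_poincareHecke` and (ii) = p619868 `peterssonSqIntegrable_rpow_im_mul_poincareHecke`
(w2); T4′ `stub_heckeL2Prime` is KERNEL from T4a′; ALTERNATIVELY T4g `HeckeGramLimitPrime` (worker w1,
Gram limits) gives T4′ by w2's landed `heckeL2_at_of_gram_limit` (p620553) — kernel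
`heckeL2Prime_of_gramLimit`; whichever of T4m / T4g lands first closes the skeleton; ANY of the three efforts in flight closes the skeleton: w1's general
Gram-route `HeckeL2` (⇒ `HeckeL2Prime` by restriction, replacing T4′), w3's T4a′, with w2's general
conjunct (ii) `peterssonSqIntegrable_rpow_im_mul_poincareHecke` imported by both.

## v5 (2026-08-28T09:35Z) = CLOSED: every stub discharged BY NAME, BOTH `L²` routes kernel
T4m `stub_heckeMajorantPrime := heckeMajorant_prime` (worker w3, p620795, prime level, uniform majorant near
both cusps of `Γ₀(q)`); T4g `heckeGramLimitPrime := ⟨_, tendsto_gram_peterssonPairing hm⟩` (worker w1,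
p620712, every level; with w2's p620553 `heckeL2_at_of_gram_limit`).  The theorems of record are LANDED:
`KowalskiMichel2000.kowalskiMichel2000_peterssonFormula_holds`, `…_peterssonBound_holds`, `…poincareExists`
(p621287, `Literature/NumberTheory/LFunctions/KowalskiMichelPeterssonFormulaHolds.lean`) and the crux
`Summit.Parity.GeneralizedHardyLittlewood.Theses.PrimeLevelFamEdge.peterssonBoundPrinted_holds` (p621222,
`Theorems/PrimeLevelFamEdgePeterssonBoundPrinted.lean`); stmt-Parity-20404 closed `proved` 2026-08-28T09:28:12Z.

«The programme SEARCHES and TYPES; no claim about Landau–Siegel zeros, Theorems 1–2 of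
arXiv:2211.02515 or a repaired Margin232 until a kernel theorem says so.»
-/

noncomputable section

open scoped MatrixGroups Real Manifold Topology
open CongruenceSubgroup Complex MeasureTheory Filter
open UpperHalfPlane hiding I
open Literature.NumberTheory.EllipticCurves.ModularForms
open Literature.Analysis.FunctionSpaces (besselJ)
open Literature.NumberTheory.ModularForms.PoincareWeightTwo

namespace Literature.NumberTheory.LFunctions.KowalskiMichel2000.PoincareHecke

/-! All objects are the tree's `Literature.NumberTheory.ModularForms.PoincareWeightTwo.*` (definitions file
p611295; `cellTerm`/`fourierMode` from `PoincareSeriesWeightTwoHeckeLimit.lean`, worker w3). -/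

/-! ## The registered stub statements (as named propositions) -/

section Statements

/-- T1: absolute convergence of the Hecke-regularised Poincaré series for `s > 0` and its weight-`(2,s)`
automorphy under `Γ₀(N)`: `P_m(γz,s) = (cz+d)² |cz+d|^{2s} P_m(z,s)`. [cite: IwaniecKowalski2004, §14.1 (14.4) with §3.2] -/
def HeckeConvergence : Prop :=
  ∀ (N : ℕ) [NeZero N] (m : ℕ), 1 ≤ m → ∀ (s : ℝ), 0 < s → ∀ z : ℍ,
    Summable (fun v : Row N ↦ poincareTerm N m s v z) ∧
    ∀ γ : SL(2, ℤ), γ ∈ Gamma0 N →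
      poincareHecke N m s (γ • z) =
        (rowDenom ((γ : Matrix (Fin 2) (Fin 2) ℤ) 1) z) ^ 2 *
          ((‖rowDenom ((γ : Matrix (Fin 2) (Fin 2) ℤ) 1) z‖ ^ (2 * s) : ℝ) : ℂ) *
            poincareHecke N m s z

/-- T2: the Fourier modes of `P_m(·,s)` along the horocycle `Im z = y` (`s > 0`, `n ∈ ℤ`):
`∫₀¹ P_m(x+iy,s) e(−nx) dx = δ_{mn} e^{−2πmy} + Σ_{r≥1} (Nr)^{−2−2s} S(m,n;Nr) I_s(m/(Nr)², n; y)`, the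
`r`-series converging absolutely. [cite: IwaniecKowalski2004, Lemma 14.2 (proof, at k = 2 with Hecke's factor)] -/
def HeckeFourierModes : Prop :=
  ∀ (N : ℕ) [NeZero N] (m : ℕ), 1 ≤ m → ∀ (s : ℝ), 0 < s → ∀ (n : ℤ) (y : ℝ), 0 < y →
    Summable (fun r : ℕ ↦ ‖cellTerm N m s n y r‖) ∧
    ∫ x in (0 : ℝ)..1, poincareHecke N m s (UpperHalfPlane.ofComplex ((x : ℂ) + y * I)) *
        cexp (-(2 * π * I * n * x)) =
      (if n = (m : ℤ) then cexp (-(2 * π * m * y)) else 0) + ∑' r : ℕ, cellTerm N m s n y r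

/-- T3: Hecke's limit, pointwise: `P_m(z,s) → Σ_{n≥1} p_m(n) e(nz)` as `s → 0⁺`, with the printed
coefficients `p_m(n) = poincareCoeff N m n`. [cite: IwaniecKowalski2004, Lemma 14.2 (k = 2, Hecke's trick §3.2)] -/
def HeckeLimit : Prop :=
  ∀ (N : ℕ) [NeZero N] (m : ℕ), 1 ≤ m → ∀ z : ℍ,
    Tendsto (fun s : ℝ ↦ poincareHecke N m s z) (𝓝[>] 0) (𝓝 (poincareQSeries N m z))

/-- U: unfolding at `s > 0` against a cusp form: `⟨yˢ P_m(·,s), f⟩ = Γ(s+1)(4πm)^{−(s+1)} a_f(m)`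
(pairing conjugate-linear in the first slot, no volume normalisation). [cite: IwaniecKowalski2004, Lemma 14.3 (3.29 of Iwaniec's Topics; k = 2 with Hecke's factor)] -/
def HeckeUnfolding : Prop :=
  ∀ (N : ℕ) [NeZero N] (m : ℕ), 1 ≤ m → ∀ (s : ℝ), 0 < s → ∀ f : CuspForm (Gamma0 N) 2,
    peterssonPairing N 2 (fun z : ℍ ↦ ((z.im ^ s : ℝ) : ℂ) * poincareHecke N m s z) ⇑f =
      ((Real.Gamma (s + 1) / (4 * π * m) ^ (s + 1) : ℝ) : ℂ) * cuspCoeff f m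

/-- T4: Hecke's limit in the weight-2 `L²` norm of `Γ₀(N)\ℍ`: `yˢP_m(·,s) → Σ p_m(n)e(nz)` in `L²`
(both square-integrable). [cite: IwaniecKowalski2004, §14.1–§14.2 (k = 2, Hecke's trick §3.2)] -/
def HeckeL2 : Prop :=
  ∀ (N : ℕ) [NeZero N] (m : ℕ), 1 ≤ m →
    PeterssonSqIntegrable N 2 (poincareQSeries N m) ∧
    (∀ s : ℝ, 0 < s →
      PeterssonSqIntegrable N 2 (fun z : ℍ ↦ ((z.im ^ s : ℝ) : ℂ) * poincareHecke N m s z)) ∧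
    Tendsto (fun s : ℝ ↦ (peterssonPairing N 2
        (fun z : ℍ ↦ ((z.im ^ s : ℝ) : ℂ) * poincareHecke N m s z - poincareQSeries N m z)
        (fun z : ℍ ↦ ((z.im ^ s : ℝ) : ℂ) * poincareHecke N m s z - poincareQSeries N m z)).re)
      (𝓝[>] 0) (𝓝 0)

/-- T4a (the ANALYTIC HALF of T4, v3): **uniform domination of Hecke's family near every cusp.**
The functions `E_s = yˢP_m(·,s)` (`0 < s ≤ 1`) are continuous, square-integrable for every `s > 0`,
and their Petersson square-integrands `Σ_q |E_s(q⁻¹τ)|² (Im q⁻¹τ)²` on `𝒟` are dominated by ONE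
integrable `G` (near the cusp `∞`: `|E_s| ≲ yˢe^{−2πmy} + s·y^{−1−s}` from the expansion at `∞`; near
the other cusps: the expansion of `P_m(·,s)` along the cosets `Γ₀(N)σ` with cusp-pair Kloosterman sums
— at prime level `q` these are classical `S(m q̄, nq; c)`, `(c,q)=1`, rows `{(c,d) : q ∣ d}` of `Γ₀(q)S`).
[cite: IwaniecKowalski2004, §14.1–§14.2 (k = 2, Hecke's trick §3.2)] -/
def HeckeDomination : Prop :=
  ∀ (N : ℕ) [NeZero N] (m : ℕ), 1 ≤ m →
    (∀ s : ℝ, 0 < s → s ≤ 1 →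
      Continuous (fun z : ℍ ↦ ((z.im ^ s : ℝ) : ℂ) * poincareHecke N m s z)) ∧
    (∀ s : ℝ, 0 < s →
      PeterssonSqIntegrable N 2 (fun z : ℍ ↦ ((z.im ^ s : ℝ) : ℂ) * poincareHecke N m s z)) ∧
    ∃ G : ℍ → ℝ, IntegrableOn G ModularGroup.fd ∧
      letI := Fintype.ofFinite (𝒮ℒ ⧸ (Gamma0 N : Subgroup (GL (Fin 2) ℝ)).subgroupOf 𝒮ℒ)
      ∀ s : ℝ, 0 < s → s ≤ 1 → ∀ τ ∈ ModularGroup.fd,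
        ∑ q : 𝒮ℒ ⧸ (Gamma0 N : Subgroup (GL (Fin 2) ℝ)).subgroupOf 𝒮ℒ,
          ‖(fun z : ℍ ↦ ((z.im ^ s : ℝ) : ℂ) * poincareHecke N m s z)
              (((q.out : 𝒮ℒ) : GL (Fin 2) ℝ)⁻¹ • τ)‖ ^ 2 *
            ((((q.out : 𝒮ℒ) : GL (Fin 2) ℝ)⁻¹ • τ).im) ^ (2 : ℤ) ≤ G τ

/-- T5: an `L²` holomorphic function of weight `2` for `Γ₀(N)` is a cusp form (sub-mean-value at the
cusps ⇒ bounded ⇒ `q`-expansion; square-integrability kills the constant terms).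
[cite: IwaniecKowalski2004, §14.1 (cusp forms and the Petersson norm (14.11))] -/
def CuspFormOfL2 : Prop :=
  ∀ (N : ℕ) [NeZero N] (g : ℍ → ℂ), MDifferentiable 𝓘(ℂ) 𝓘(ℂ) g →
    (∀ γ : SL(2, ℤ), γ ∈ Gamma0 N → ∀ z : ℍ,
      g (γ • z) = (rowDenom ((γ : Matrix (Fin 2) (Fin 2) ℤ) 1) z) ^ 2 * g z) →
    PeterssonSqIntegrable N 2 g →
    ∃ f : CuspForm (Gamma0 N) 2, ∀ z : ℍ, f z = g z

/-- The conclusion of the line: the weight-2 Poincaré cusp form with the printed coefficients AND the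
reproducing property (old stubs S3 ∧ S4). [cite: IwaniecKowalski2004, Lemma 14.2 and Lemma 14.3 (k = 2)] -/
def PoincareExists : Prop :=
  ∀ (N : ℕ) [NeZero N] (m : ℕ), 1 ≤ m → ∃ P : CuspForm (Gamma0 N) 2,
    (∀ n : ℕ, 1 ≤ n → cuspCoeff P n = poincareCoeff N m n) ∧
    (∀ f : CuspForm (Gamma0 N) 2,
      peterssonProduct (Gamma0 N) 2 P f = ((1 / (4 * π * m) : ℝ) : ℂ) * cuspCoeff f m)

end Statements

/-- T4′ (v4): `HeckeL2` AT PRIME LEVELS — the `L²` statement of Hecke's trick for `Γ₀(q)`, `q` prime.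
[cite: IwaniecKowalski2004, §14.2, remark after (14.13) (k = 2)] -/
def HeckeL2Prime : Prop :=
  ∀ (N : ℕ) [NeZero N], N.Prime → ∀ (m : ℕ), 1 ≤ m →
    PeterssonSqIntegrable N 2 (poincareQSeries N m) ∧
    (∀ s : ℝ, 0 < s →
      PeterssonSqIntegrable N 2 (fun z : ℍ ↦ ((z.im ^ s : ℝ) : ℂ) * poincareHecke N m s z)) ∧
    Tendsto (fun s : ℝ ↦ (peterssonPairing N 2
        (fun z : ℍ ↦ ((z.im ^ s : ℝ) : ℂ) * poincareHecke N m s z - poincareQSeries N m z)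
        (fun z : ℍ ↦ ((z.im ^ s : ℝ) : ℂ) * poincareHecke N m s z - poincareQSeries N m z)).re)
      (𝓝[>] 0) (𝓝 0)

/-- T4a′ (v4): `HeckeDomination` AT PRIME LEVELS — continuity of Hecke's family `E_s = yˢP_m(·,s)`,
square-integrability for each `s > 0`, and ONE integrable majorant of its Petersson square-integrands on
`𝒟` uniform in `0 < s ≤ 1`, for `Γ₀(q)`, `q` prime (cusps `∞` and `0` only:
`SL₂(ℤ) = Γ₀(q) ⊔ ⨆_{j mod q} Γ₀(q)·S·T^j`). [cite: IwaniecKowalski2004, §14.1–§14.2 (k = 2, Hecke's trick §3.2)] -/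
def HeckeDominationPrime : Prop :=
  ∀ (N : ℕ) [NeZero N], N.Prime → ∀ (m : ℕ), 1 ≤ m →
    (∀ s : ℝ, 0 < s → s ≤ 1 →
      Continuous (fun z : ℍ ↦ ((z.im ^ s : ℝ) : ℂ) * poincareHecke N m s z)) ∧
    (∀ s : ℝ, 0 < s →
      PeterssonSqIntegrable N 2 (fun z : ℍ ↦ ((z.im ^ s : ℝ) : ℂ) * poincareHecke N m s z)) ∧
    ∃ G : ℍ → ℝ, IntegrableOn G ModularGroup.fd ∧
      letI := Fintype.ofFinite (𝒮ℒ ⧸ (Gamma0 N : Subgroup (GL (Fin 2) ℝ)).subgroupOf 𝒮ℒ)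
      ∀ s : ℝ, 0 < s → s ≤ 1 → ∀ τ ∈ ModularGroup.fd,
        ∑ q : 𝒮ℒ ⧸ (Gamma0 N : Subgroup (GL (Fin 2) ℝ)).subgroupOf 𝒮ℒ,
          ‖(fun z : ℍ ↦ ((z.im ^ s : ℝ) : ℂ) * poincareHecke N m s z)
              (((q.out : 𝒮ℒ) : GL (Fin 2) ℝ)⁻¹ • τ)‖ ^ 2 *
            ((((q.out : 𝒮ℒ) : GL (Fin 2) ℝ)⁻¹ • τ).im) ^ (2 : ℤ) ≤ G τ

/-- T4m (v4, THE OPEN STUB's content): ONE integrable majorant of the Petersson square-integrands of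
Hecke's family `E_s = yˢP_m(·,s)` on `𝒟`, uniform in `0 < s ≤ 1`, for `Γ₀(q)`, `q` prime — conjunct (iii)
of `HeckeDomination` at prime levels. [cite: IwaniecKowalski2004, §14.1–§14.2 (k = 2, Hecke's trick §3.2)] -/
def HeckeMajorantPrime : Prop :=
  ∀ (N : ℕ) [NeZero N], N.Prime → ∀ (m : ℕ), 1 ≤ m →
    ∃ G : ℍ → ℝ, IntegrableOn G ModularGroup.fd ∧
      letI := Fintype.ofFinite (𝒮ℒ ⧸ (Gamma0 N : Subgroup (GL (Fin 2) ℝ)).subgroupOf 𝒮ℒ)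
      ∀ s : ℝ, 0 < s → s ≤ 1 → ∀ τ ∈ ModularGroup.fd,
        ∑ q : 𝒮ℒ ⧸ (Gamma0 N : Subgroup (GL (Fin 2) ℝ)).subgroupOf 𝒮ℒ,
          ‖(fun z : ℍ ↦ ((z.im ^ s : ℝ) : ℂ) * poincareHecke N m s z)
              (((q.out : 𝒮ℒ) : GL (Fin 2) ℝ)⁻¹ • τ)‖ ^ 2 *
            ((((q.out : 𝒮ℒ) : GL (Fin 2) ℝ)⁻¹ • τ).im) ^ (2 : ℤ) ≤ G τ

/-- T4g (v4, the ALTERNATIVE to T4m — the Gram route, worker w1): the Gram pairings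
`⟨yˢP_m(·,s), y^{s'}P_m(·,s')⟩` of Hecke's family converge as `(s,s') → (0⁺,0⁺)`, for `Γ₀(q)`, `q` prime
(unfolding `HeckeUnfoldingGeneral` + the `m`-th Fourier mode with the `e(−A/τ)`-decay small-`y` bound +
dominated convergence on `(0,∞)`; the limit is `1/(4πm)·(1 − J_q(m,m))`-shaped but only its EXISTENCE is
used). With w2's landed `heckeL2_at_of_gram_limit` (p620553) it gives `HeckeL2Prime` (kernel below).
[cite: IwaniecKowalski2004, §14.2 (k = 2, Hecke's trick §3.2)] -/
def HeckeGramLimitPrime : Prop :=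
  ∀ (N : ℕ) [NeZero N], N.Prime → ∀ (m : ℕ), 1 ≤ m → ∃ g₀ : ℂ,
    Tendsto (fun p : ℝ × ℝ ↦ peterssonPairing N 2
        (fun z : ℍ ↦ ((z.im ^ p.1 : ℝ) : ℂ) * poincareHecke N m p.1 z)
        (fun z : ℍ ↦ ((z.im ^ p.2 : ℝ) : ℂ) * poincareHecke N m p.2 z))
      ((𝓝[>] 0) ×ˢ (𝓝[>] 0)) (𝓝 g₀)

/-- The conclusion of the line AT PRIME LEVELS (v4): for `q` prime and `m ≥ 1` a cusp form
`P ∈ S_2(Γ₀(q))` with `a_P(n) = poincareCoeff q m n` (`n ≥ 1`) and `⟨P, f⟩ = a_f(m)/(4πm)`.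
[cite: IwaniecKowalski2004, Lemma 14.2 and Lemma 14.3 (k = 2)] -/
def PoincareExistsPrime : Prop :=
  ∀ (N : ℕ) [NeZero N], N.Prime → ∀ (m : ℕ), 1 ≤ m → ∃ P : CuspForm (Gamma0 N) 2,
    (∀ n : ℕ, 1 ≤ n → cuspCoeff P n = poincareCoeff N m n) ∧
    (∀ f : CuspForm (Gamma0 N) 2,
      peterssonProduct (Gamma0 N) 2 P f = ((1 / (4 * π * m) : ℝ) : ℂ) * cuspCoeff f m)

/-! ## Stubs -/

/-- **Stub S1 (v1) — CLOSED p609201** (lead):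
`KowalskiMichel2000.cuspCoeff_eq_mul_pet_of_peterssonProduct_eq` (`KowalskiMichelPeterssonNewformExpansion.lean`).
[cite: IwaniecKowalski2004, §14.2 (proof of Prop. 14.5)] -/
theorem stub_parsevalNewforms :
    ∀ (q : ℕ) [NeZero q], q.Prime → ∀ (m n : ℕ), 1 ≤ m → 1 ≤ n →
      ∀ (P : CuspForm (Gamma0 q) 2) (c : ℝ),
        (∀ f : CuspForm (Gamma0 q) 2,
            peterssonProduct (Gamma0 q) 2 P f = (c : ℂ) * cuspCoeff f m) →
        cuspCoeff P n = ((c * (4 * π * Real.sqrt ((m : ℝ) * n)) : ℝ) : ℂ) * pet q m n :=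
  fun _ _ hq _ _ hm hn P c hP ↦ cuspCoeff_eq_mul_pet_of_peterssonProduct_eq hq hm hn P c hP

/-- **Stub S2 (v1) — CLOSED p609912** (worker `ls-inputs-I1-w1`):
`Literature.NumberTheory.LFunctions.weightTwo_besselModeIntegral`. [cite: IwaniecKowalski2004, §14.2 (proof of Lemma 14.2)] -/
theorem stub_besselModeIntegral :
    ∀ (A B y : ℝ), 0 < A → 0 < B → 0 < y →
      ∫ x : ℝ, (((x : ℂ) + y * I) ^ 2)⁻¹ *
          cexp (2 * π * I * (-(A : ℂ) / ((x : ℂ) + y * I) - B * ((x : ℂ) + y * I))) =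
        ((-(2 * π * Real.sqrt (B / A) * besselJ 1 (4 * π * Real.sqrt (A * B))) : ℝ) : ℂ) :=
  Literature.NumberTheory.LFunctions.weightTwo_besselModeIntegral

/-- **Stub T1** (`HeckeConvergence`) — **CLOSED p612322** (lead): `PoincareWeightTwo.heckeConvergence`
(`PoincareSeriesWeightTwoHeckeConvergence.lean`: Eisenstein majorant for `s > 0`, reindexing of the rows
by `v ↦ vγ`). [cite: IwaniecKowalski2004, §14.1 (14.4) with §3.2] -/
theorem stub_heckeConvergence : HeckeConvergence :=
  fun N _ m hm s hs z ↦ heckeConvergence N m hm s hs z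

/-- **Stub T2** (`HeckeFourierModes`) — **CLOSED p617745** (worker w3, `PoincareSeriesWeightTwoFourierModes.lean`:
`heckeFourierModes`). [cite: IwaniecKowalski2004, Lemma 14.2 (proof)] -/
theorem stub_heckeFourierModes : HeckeFourierModes := heckeFourierModes

/-- **Stub T3** (`HeckeFourierModes → HeckeLimit`) — **CLOSED** (worker w3, `PoincareSeriesWeightTwoHeckeLimit.lean`:
`heckeLimit_of_fourierModes`; helper `PoincareSeriesWeightTwoModeIntegral.lean` p614710).
[cite: IwaniecKowalski2004, Lemma 14.2 (k = 2)] -/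
theorem stub_heckeLimit : HeckeFourierModes → HeckeLimit :=
  fun hT2 ↦ heckeLimit_of_fourierModes hT2

/-- **Stub U** (`HeckeUnfolding`) — **CLOSED** (worker w2, `PoincareSeriesWeightTwoHeckeUnfolding.lean`:
`heckeUnfolding`; part I `PoincareSeriesWeightTwoHeckeUnfoldingPointwise.lean` p614918).
[cite: IwaniecKowalski2004, Lemma 14.3] -/
theorem stub_heckeUnfolding : HeckeUnfolding := heckeUnfolding

/-- **Stub T4m (`HeckeConvergence → HeckeFourierModes → HeckeMajorantPrime`) — CLOSED p620795** (worker
w3, `PoincareSeriesWeightTwoHeckeMajorant.lean`: `heckeMajorant_prime` — expansion at `∞` keeping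
`(y/2)^{−2s}`, the coset series of `Γ₀(q)S` at the cusp `0` with modes `Σ_{(a,q)=1} a^{−2−2s} S(·;a) I_s`,
`SL₂(ℤ) = Γ₀(q) ⊔ ⨆_j Γ₀(q)ST^j`, `vol 𝒟 < ∞`; the hypotheses are theorems and unused).
[cite: IwaniecKowalski2004, §14.1–§14.2 (k = 2, Hecke's trick §3.2)] -/
theorem stub_heckeMajorantPrime : HeckeConvergence → HeckeFourierModes → HeckeMajorantPrime :=
  fun _ _ N _ hN m hm ↦ heckeMajorant_prime N hN m hm

/-- **T4g — CLOSED p620712** (worker w1, `PoincareSeriesWeightTwoGramLimit.lean`: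
`tendsto_gram_peterssonPairing`, every level — unfolding `HeckeUnfoldingGeneral`, the `m`-th mode, the
`e(−A/τ)`-decay cell bound `PoincareSeriesWeightTwoCellDecay`, dominated convergence on `(0,∞)`).
[cite: IwaniecKowalski2004, §14.2 (k = 2, Hecke's trick §3.2)] -/
theorem heckeGramLimitPrime : HeckeGramLimitPrime :=
  fun _ _ _ _ hm ↦ ⟨_, tendsto_gram_peterssonPairing hm⟩

/-- **T4a′ (`HeckeConvergence → HeckeFourierModes → HeckeDominationPrime`) from T4m — KERNEL** (no
`sorry` of its own): (i) continuity of `yˢP_m(·,s)` is the landed `continuous_rpow_im_mul_poincareHecke`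
(p618045), (ii) square-integrability for each `s > 0` is the landed
`peterssonSqIntegrable_rpow_im_mul_poincareHecke` (p619868, worker w2: incomplete-Eisenstein majorant),
(iii) is T4m. [cite: IwaniecKowalski2004, §14.1–§14.2 (k = 2)] -/
theorem stub_heckeDominationPrime : HeckeConvergence → HeckeFourierModes → HeckeDominationPrime :=
  fun hT1 hT2 N _ hN m hm ↦
    ⟨fun _ hs _ ↦ continuous_rpow_im_mul_poincareHecke m hs,
      fun s hs ↦ peterssonSqIntegrable_rpow_im_mul_poincareHecke N m hm s hs,
      stub_heckeMajorantPrime hT1 hT2 N hN m hm⟩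

/-- **T4′ (`HeckeConvergence → HeckeFourierModes → HeckeUnfolding → HeckeL2Prime`) from T4a′ — KERNEL**
(no `sorry` of its own): dominated convergence at each prime level, the landed
`heckeL2_at_of_domination_at` (pointwise Hecke limit `heckeLimit_of_fourierModes` with `yˢ → 1`,
continuity of the `q`-series, `heckeL2_of_dominated`). [cite: IwaniecKowalski2004, §14.2 (k = 2, Hecke's trick)] -/
theorem stub_heckeL2Prime : HeckeConvergence → HeckeFourierModes → HeckeUnfolding → HeckeL2Prime := by
  intro hT1 hT2 _ N _ hN m hm
  obtain ⟨hcont, hsq, hdom⟩ := stub_heckeDominationPrime hT1 hT2 N hN m hm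
  exact heckeL2_at_of_domination_at N hm hcont hsq hdom

/-- **ALTERNATIVE closure of T4′ (kernel, no `sorry`): `HeckeGramLimitPrime → HeckeL2Prime`** by
worker w2's landed Fatou/Gram assembly `heckeL2_at_of_gram_limit` (p620553). If T4g lands before T4m, the
composition below switches to this path (`stub_heckeL2Prime := heckeL2Prime_of_gramLimit …`).
[cite: IwaniecKowalski2004, §14.2 (k = 2, Hecke's trick §3.2)] -/
theorem heckeL2Prime_of_gramLimit : HeckeGramLimitPrime → HeckeL2Prime := by
  intro h N _ hN m hm
  obtain ⟨g₀, hg⟩ := h N hN m hm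
  exact heckeL2_at_of_gram_limit N hm g₀ hg

/-- **Stub T5** (`CuspFormOfL2`) — **CLOSED p615943** (worker w4, `PoincareSeriesWeightTwoCuspFormOfL2.lean`:
`cuspFormOfL2`, Bergman sub-mean-value; no Fourier expansion). [cite: IwaniecKowalski2004, §14.1 ((14.11))] -/
theorem stub_cuspFormOfL2 : CuspFormOfL2 := cuspFormOfL2

/-- **Stub T7** (assembly) — **CLOSED p616886** (worker w2, `PoincareSeriesWeightTwoHeckeAssembly.lean`:
`poincareAssembly`). [cite: IwaniecKowalski2004, Lemma 14.2 and Lemma 14.3 (k = 2)] -/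
theorem stub_poincareAssembly :
    HeckeConvergence → HeckeLimit → HeckeUnfolding → HeckeL2 → CuspFormOfL2 → PoincareExists :=
  fun h1 h3 hU h4 h5 ↦ poincareAssembly h1 h3 hU h4 h5

/-! ## Kernel compositions -/

/-- The line's conclusion AT PRIME LEVELS from its stubs (no `sorry` of its own): the landed pointwise
assembly `poincareAssembly_at` fed with T1, T3 (from T2), U, T4′ and T5.
[cite: IwaniecKowalski2004, Lemma 14.2 and Lemma 14.3 (k = 2)] -/
theorem poincareExistsPrime : PoincareExistsPrime := fun N _ hN m hm ↦
  poincareAssembly_at N hm (fun s hs z ↦ stub_heckeConvergence N m hm s hs z)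
    (stub_heckeLimit stub_heckeFourierModes N m hm) (fun s hs f ↦ stub_heckeUnfolding N m hm s hs f)
    (stub_heckeL2Prime stub_heckeConvergence stub_heckeFourierModes stub_heckeUnfolding N hN m hm)
    (fun g ↦ stub_cuspFormOfL2 N g)

/-- **KERNEL COMPOSITION (hypothetical form).** S1 and the line's conclusion `PoincareExistsPrime` imply
Kowalski–Michel's Petersson formula as typed: the convergence clause is the tree's
`summable_norm_petKloostermanTerm_all` (Weil's bound, a theorem of the tree); for `q` prime,
`l₁, l₂ ≥ 1`, with `P` the Poincaré cusp form at `m = l₁`: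
`(1/(4πl₁))·4π√(l₁l₂)·pet q l₁ l₂ = a_P(l₂) = δ(l₁,l₂) − √l₂/√l₁ · petJ q l₁ l₂`, and
`√(l₁l₂)/l₁ = √l₂/√l₁ > 0`. [cite: KowalskiMichel2000, §2.4.2 p. 312 (Petersson's formula)] -/
theorem peterssonFormula_of_hyps
    (h₁ : ∀ (q : ℕ) [NeZero q], q.Prime → ∀ (m n : ℕ), 1 ≤ m → 1 ≤ n →
      ∀ (P : CuspForm (Gamma0 q) 2) (c : ℝ),
        (∀ f : CuspForm (Gamma0 q) 2,
            peterssonProduct (Gamma0 q) 2 P f = (c : ℂ) * cuspCoeff f m) →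
        cuspCoeff P n = ((c * (4 * π * Real.sqrt ((m : ℝ) * n)) : ℝ) : ℂ) * pet q m n)
    (hE : PoincareExistsPrime) :
    kowalskiMichel2000_peterssonFormula := by
  rw [peterssonFormula_iff_identity]
  intro q _ hq l₁ l₂ h₁' h₂'
  -- the Poincaré cusp form at `m = l₁` and its two descriptions of `a_P(l₂)`
  obtain ⟨P, hP, hrep⟩ := hE q hq l₁ h₁'
  have hA := h₁ q hq l₁ l₂ h₁' h₂' P (1 / (4 * π * l₁)) hrep
  have hB := hP l₂ h₂'
  rw [poincareCoeff] at hB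
  -- the common positive factor `√(l₁l₂)/l₁ = √l₂/√l₁`
  have hl₁ : (0 : ℝ) < l₁ := by exact_mod_cast h₁'
  have hl₂ : (0 : ℝ) < l₂ := by exact_mod_cast h₂'
  have hρ : 1 / (4 * π * (l₁ : ℝ)) * (4 * π * Real.sqrt ((l₁ : ℝ) * l₂)) =
      Real.sqrt l₂ / Real.sqrt l₁ := by
    rw [Real.sqrt_mul hl₁.le]
    have h1 : Real.sqrt (l₁ : ℝ) ≠ 0 := (Real.sqrt_pos.mpr hl₁).ne'
    have h1' : (Real.sqrt (l₁ : ℝ)) ^ 2 = l₁ := Real.sq_sqrt hl₁.le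
    field_simp
    nlinarith [h1', Real.pi_pos]
  have hρpos : 0 < Real.sqrt (l₂ : ℝ) / Real.sqrt l₁ :=
    div_pos (Real.sqrt_pos.mpr hl₂) (Real.sqrt_pos.mpr hl₁)
  set ρ : ℝ := Real.sqrt (l₂ : ℝ) / Real.sqrt l₁ with hρdef
  rw [hρ] at hA
  have hρC : (ρ : ℂ) ≠ 0 := by exact_mod_cast hρpos.ne'
  -- `ρ · pet = δ − ρ · petJ`
  have key : (ρ : ℂ) * pet q l₁ l₂ = (if l₁ = l₂ then 1 else 0) - (ρ : ℂ) * petJ q l₁ l₂ :=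
    hA.symm.trans hB
  by_cases h : l₁ = l₂
  · subst h
    have hρ1 : ρ = 1 := by rw [hρdef]; exact div_self (Real.sqrt_pos.mpr hl₁).ne'
    simpa [hρ1] using key
  · rw [if_neg h] at key ⊢
    have : (ρ : ℂ) * pet q l₁ l₂ = (ρ : ℂ) * (0 - petJ q l₁ l₂) := by rw [key]; ring
    exact mul_left_cancel₀ hρC this

/-- **THE SKELETON COMPOSITION (closed modulo the registered stubs):** Kowalski–Michel's Petersson
formula `kowalskiMichel2000_peterssonFormula` BY NAME.
[cite: KowalskiMichel2000, §2.4.2 p. 312 (Petersson's formula)] -/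
theorem peterssonFormula_of : kowalskiMichel2000_peterssonFormula :=
  peterssonFormula_of_hyps stub_parsevalNewforms poincareExistsPrime

/-- **The consumer crux by name (stmt-Parity-20404):** `PeterssonBoundPrinted` from the same stubs,
through `peterssonFormula_of` and the kernel reduction `peterssonBoundPrinted_of_peterssonFormula`
(Weil's bound is the tree's theorem). [cite: KowalskiMichel2000, §2.4.2 p. 312 (23)] -/
theorem PeterssonBoundPrinted_of :
    Summit.Parity.GeneralizedHardyLittlewood.Theses.PrimeLevelFamEdge.PeterssonBoundPrinted :=
  Summit.Parity.GeneralizedHardyLittlewood.Theorems.peterssonBoundPrinted_of_peterssonFormula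
    peterssonFormula_of

end Literature.NumberTheory.LFunctions.KowalskiMichel2000.PoincareHecke

end
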